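import Mathlib
import Summits.PneNP.PneNP.Theorems.AeaCutRectanglesCriticalSupport

/-!
# IdeasR2s2g12 — seat 2, gen 12 (crux `FoolingMeasure`, stmt-PneNP-19727)

Construct-side design lemmas found while hunting NON-product support families (A10).
FRONTIER restricted-model rung (AEA cut rectangles vs NON-3-COL); nothing here bears on P vs NP.

* `sum_cls_eq` / `dvd_sum_cls` — double counting: for a 3-colouring `c` and a finite triple
  system `H`, the number of (triple, vertex-of-colour-k) incidences is `∑_{v : c v = k} hdeg H v`;
  so a common divisor `m` of all hyperdegrees divides it.
* `no_near_colouring_of_dvd_hdeg` — THE GCD OBSTRUCTION: if `m ≥ 2` divides every hyperdegree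
  of a triple system `H` (all `h ∈ H` of size 3), then NO 3-colouring has exactly one
  monochromatic pair summed over the triples.  For a LINEAR `H` the shadow graph's edges are in
  bijection with (triple, pair) so this says: the shadow of an `r`-regular linear 3-graph
  (`r ≥ 2`) has no near-colouring (colouring with exactly one monochromatic edge), hence is
  never 4-edge-critical.  Paper proof: a triple contributes 0 (rainbow), 1 (pattern aab) or 3
  (aaa) monochromatic pairs; total 1 forces one aab-triple and all others rainbow, so the three
  colour-incidence counts are `T+1, T, T-1` (`T = |H|`), all divisible by `m`, whence `m ∣ 1`.
* `flow_vanishes_at_defect` — THE Z₃-FLOW OBSTRUCTION (proved): colourings as `ZMod 3`-valued;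
  rainbow triples sum to 0, the defect triple `aab` to `b-a ≠ 0`; double counting against any
  vertex-flow `y` on the triple family gives `y h₀ = 0`.  Corollary `CriticalTrianglePackingsAcyclic`
  (statement): edge-disjoint triangle families in 4-edge-critical graphs are Z₃-acyclic, `≤ n-1`
  members; the census S1-CSP object (hyperdegree-4 linear systems with critical shadow) is empty.
* `RegularShadowNotCritical` — the graph-level corollary as a statement over the tree's
  `AeaCutRectanglesCriticalSupport.IsEdgeCritical` (bookkeeping `#mono shadow edges = monoTotal`
  for LINEAR systems left to a prover; the arithmetic core above is proved).
* `ToftFrameDark` — statement only (design lemma D2 of RESULTS-r2s2g12 §3).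
-/

namespace Summit.PneNP.PneNP.Cruxes.FoolingMeasure.IdeasR2s2g12

open Finset

variable {n : ℕ}

/-- hyperdegree of `v` in the triple system `H`. -/
def hdeg (H : Finset (Finset (Fin n))) (v : Fin n) : ℕ := ∑ h ∈ H, if v ∈ h then 1 else 0

/-- number of vertices of colour `k` in the triple `h`. -/
def cls (c : Fin n → Fin 3) (k : Fin 3) (h : Finset (Fin n)) : ℕ := ∑ v ∈ h, if c v = k then 1 else 0

/-- number of monochromatic pairs inside `h`. -/
def monoPairs (c : Fin n → Fin 3) (h : Finset (Fin n)) : ℕ := ∑ k : Fin 3, (cls c k h).choose 2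

/-- total number of monochromatic (triple, pair) incidences = number of monochromatic shadow
edges when `H` is linear. -/
def monoTotal (c : Fin n → Fin 3) (H : Finset (Finset (Fin n))) : ℕ := ∑ h ∈ H, monoPairs c h

/-- double counting of colour-`k` incidences. -/
theorem sum_cls_eq (H : Finset (Finset (Fin n))) (c : Fin n → Fin 3) (k : Fin 3) :
    ∑ h ∈ H, cls c k h = ∑ v : Fin n, if c v = k then hdeg H v else 0 := by
  classical
  unfold cls hdeg
  have : ∀ h ∈ H, (∑ v ∈ h, if c v = k then 1 else 0)
      = ∑ v : Fin n, if v ∈ h then (if c v = k then 1 else 0) else 0 := by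
    intro h _
    rw [Finset.sum_ite_mem, Finset.univ_inter]
  rw [Finset.sum_congr rfl this, Finset.sum_comm]
  refine Finset.sum_congr rfl ?_
  intro v _
  by_cases hv : c v = k
  · simp [hv]
  · simp [hv]

theorem dvd_sum_cls (H : Finset (Finset (Fin n))) (c : Fin n → Fin 3) (k : Fin 3)
    (m : ℕ) (hdvd : ∀ v, m ∣ hdeg H v) : m ∣ ∑ h ∈ H, cls c k h := by
  classical
  rw [sum_cls_eq]
  refine Finset.dvd_sum ?_
  intro v _
  by_cases hv : c v = k
  · simp [hv, hdvd v]
  · simp [hv]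

/-- the three colour classes partition a triple: class sizes sum to `h.card`. -/
theorem sum_cls_card (c : Fin n → Fin 3) (h : Finset (Fin n)) :
    ∑ k : Fin 3, cls c k h = h.card := by
  classical
  unfold cls
  rw [Finset.sum_comm]
  rw [Finset.card_eq_sum_ones]
  refine Finset.sum_congr rfl ?_
  intro v _
  rw [Finset.sum_ite_eq]
  simp

/-- arithmetic of one triple: class sizes `x+y+z = 3`; the number of monochromatic pairs
`C(x,2)+C(y,2)+C(z,2)` is `0` iff `(1,1,1)` and `1` iff a permutation of `(2,1,0)`. -/
theorem key_arith (x y z : ℕ) (h : x + y + z = 3) :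
    (x.choose 2 + y.choose 2 + z.choose 2 = 0 → x = 1 ∧ y = 1 ∧ z = 1) ∧
    (x.choose 2 + y.choose 2 + z.choose 2 = 1 →
      (x = 2 ∧ y = 1) ∨ (x = 2 ∧ z = 1) ∨ (y = 2 ∧ x = 1) ∨ (y = 2 ∧ z = 1) ∨
      (z = 2 ∧ x = 1) ∨ (z = 2 ∧ y = 1)) := by
  have hx : x ≤ 3 := by omega
  have hy : y ≤ 3 := by omega
  have hz : z ≤ 3 := by omega
  interval_cases x <;> interval_cases y <;> interval_cases z <;> first | (exfalso; omega) | decide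

theorem monoPairs_eq (c : Fin n → Fin 3) (h : Finset (Fin n)) :
    monoPairs c h = (cls c 0 h).choose 2 + (cls c 1 h).choose 2 + (cls c 2 h).choose 2 := by
  simp [monoPairs, Fin.sum_univ_three]

theorem cls_sum_three (c : Fin n → Fin 3) (h : Finset (Fin n)) (h3 : h.card = 3) :
    cls c 0 h + cls c 1 h + cls c 2 h = 3 := by
  have hs := sum_cls_card c h
  rw [h3] at hs
  simpa [Fin.sum_univ_three] using hs

/-- rainbow case. -/
theorem cls_of_monoPairs_zero (c : Fin n → Fin 3) (h : Finset (Fin n)) (h3 : h.card = 3)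
    (h0 : monoPairs c h = 0) : ∀ k, cls c k h = 1 := by
  have hk := (key_arith _ _ _ (cls_sum_three c h h3)).1 (by rw [← monoPairs_eq]; exact h0)
  intro k
  fin_cases k
  · exact hk.1
  · exact hk.2.1
  · exact hk.2.2

/-- one-defect case: some colour has 2 vertices and another has 1. -/
theorem cls_of_monoPairs_one (c : Fin n → Fin 3) (h : Finset (Fin n)) (h3 : h.card = 3)
    (h1 : monoPairs c h = 1) : ∃ a b : Fin 3, cls c a h = 2 ∧ cls c b h = 1 := by
  have hk := (key_arith _ _ _ (cls_sum_three c h h3)).2 (by rw [← monoPairs_eq]; exact h1)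
  rcases hk with h | h | h | h | h | h
  · exact ⟨0, 1, h.1, h.2⟩
  · exact ⟨0, 2, h.1, h.2⟩
  · exact ⟨1, 0, h.1, h.2⟩
  · exact ⟨1, 2, h.1, h.2⟩
  · exact ⟨2, 0, h.1, h.2⟩
  · exact ⟨2, 1, h.1, h.2⟩

/-- **GCD obstruction.** If `m ≥ 2` divides every hyperdegree of a triple system, no
3-colouring has exactly one monochromatic (triple,pair) incidence.  For linear systems:
the shadow of an `r`-regular linear 3-graph (`r ≥ 2`) has no near-colouring and is therefore
never 4-edge-critical. -/
theorem no_near_colouring_of_dvd_hdeg (H : Finset (Finset (Fin n)))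
    (h3 : ∀ h ∈ H, h.card = 3) (m : ℕ) (hm : 2 ≤ m) (hdvd : ∀ v, m ∣ hdeg H v)
    (c : Fin n → Fin 3) : monoTotal c H ≠ 1 := by
  classical
  intro htot
  unfold monoTotal at htot
  -- exactly one triple h₀ has monoPairs = 1, all others 0
  obtain ⟨h₀, hh₀, hone, hrest⟩ : ∃ h₀ ∈ H, monoPairs c h₀ = 1 ∧ ∀ h ∈ H, h ≠ h₀ → monoPairs c h = 0 := by
    have hex : ∃ h₀ ∈ H, monoPairs c h₀ ≠ 0 := by
      by_contra hno
      push_neg at hno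
      have : ∑ h ∈ H, monoPairs c h = 0 := Finset.sum_eq_zero hno
      omega
    obtain ⟨h₀, hh₀, hne⟩ := hex
    have hsplit := Finset.add_sum_erase H (fun h => monoPairs c h) hh₀
    rw [htot] at hsplit
    have hle : monoPairs c h₀ ≤ 1 := by omega
    have hone : monoPairs c h₀ = 1 := by omega
    refine ⟨h₀, hh₀, hone, ?_⟩
    intro h hh hneq
    have hz : ∑ x ∈ H.erase h₀, monoPairs c x = 0 := by omega
    have := Finset.sum_eq_zero_iff.mp hz h (Finset.mem_erase.mpr ⟨hneq, hh⟩)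
    exact this
  obtain ⟨a, b, ha2, hb1⟩ := cls_of_monoPairs_one c h₀ (h3 h₀ hh₀) hone
  have hrain : ∀ h ∈ H, h ≠ h₀ → ∀ k, cls c k h = 1 := by
    intro h hh hneq k
    exact cls_of_monoPairs_zero c h (h3 h hh) (hrest h hh hneq) k
  -- colour-incidence totals
  have tot : ∀ k, ∑ h ∈ H, cls c k h = cls c k h₀ + (H.erase h₀).card := by
    intro k
    rw [← Finset.add_sum_erase H (fun h => cls c k h) hh₀]
    congr 1
    rw [Finset.card_eq_sum_ones]
    refine Finset.sum_congr rfl ?_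
    intro h hh
    rw [Finset.mem_erase] at hh
    exact hrain h hh.2 hh.1 k
  have da := dvd_sum_cls H c a m hdvd
  have db := dvd_sum_cls H c b m hdvd
  rw [tot a, ha2] at da
  rw [tot b, hb1] at db
  -- m ∣ (2 + T') and m ∣ (1 + T')  ⇒  m ∣ 1
  have e : 2 + (H.erase h₀).card = (1 + (H.erase h₀).card) + 1 := by omega
  rw [e] at da
  have h1 : m ∣ 1 := (Nat.dvd_add_right db).mp da
  have := Nat.le_of_dvd Nat.one_pos h1
  omega



/-! ## Z₃-flow obstruction (the syndrome calculus)

View a 3-colouring as `c : V → ZMod 3`.  A properly coloured triangle is rainbow, so its colour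
sum is `0+1+2 = 0`; a triangle carrying the unique defect of a near-colouring has pattern `aab`,
colour sum `b - a ≠ 0`.  Hence the triangle-syndrome of a near-colouring with respect to an
edge-disjoint triangle family `ℋ` is a nonzero multiple of a unit vector `e_{h₀}`, and every
`Z₃`-flow on `ℋ` (weights `y : ℋ → Z₃` with zero sum around every vertex) is orthogonal to it:
`y h₀ = 0`.  Consequences (RESULTS-r2s2g12 §1): in a 4-edge-critical graph every edge-disjoint
triangle family is `Z₃`-acyclic, so has at most `n-1` members with `Z₃`-independent incidence
rows; shadows of linear 3-graphs with more than `n-1` triples (hyperdegree average `> 3-3/n`)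
are never 4-edge-critical; the `gcd = 3` case of the first theorem is the flow `y = 𝟙`. -/

/-- flow obstruction, abstract form: triples `H`, colouring `c` rainbow (injective) on every
triple except `h₀ = {u,v,w}` where `c u = c v ≠ c w`; any vertex-flow `y` vanishes at `h₀`. -/
theorem flow_vanishes_at_defect (H : Finset (Finset (Fin n))) (h3 : ∀ h ∈ H, h.card = 3)
    (c : Fin n → ZMod 3) (h₀ : Finset (Fin n)) (hh₀ : h₀ ∈ H)
    (hrain : ∀ h ∈ H, h ≠ h₀ → Set.InjOn c (h : Set (Fin n)))
    (u v w : Fin n) (huvw : h₀ = {u, v, w}) (hne : u ≠ v ∧ u ≠ w ∧ v ≠ w)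
    (huv : c u = c v) (hw : c w ≠ c u)
    (y : Finset (Fin n) → ZMod 3)
    (hflow : ∀ x : Fin n, ∑ h ∈ H.filter (fun h => x ∈ h), y h = 0) :
    y h₀ = 0 := by
  classical
  -- (1) double counting: S = ∑_h y h * (∑_{x∈h} c x) = ∑_x c x * (∑_{h ∋ x} y h) = 0
  have hS : ∑ h ∈ H, y h * (∑ x ∈ h, c x) = 0 := by
    have e1 : ∀ h ∈ H, y h * (∑ x ∈ h, c x)
        = ∑ x : Fin n, (if x ∈ h then y h * c x else 0) := by
      intro h _
      rw [Finset.mul_sum, Finset.sum_ite_mem, Finset.univ_inter]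
    rw [Finset.sum_congr rfl e1, Finset.sum_comm]
    refine Finset.sum_eq_zero ?_
    intro x _
    have e2 : ∑ h ∈ H, (if x ∈ h then y h * c x else 0)
        = (∑ h ∈ H.filter (fun h => x ∈ h), y h) * c x := by
      rw [Finset.sum_filter, Finset.sum_mul]
      refine Finset.sum_congr rfl ?_
      intro h _
      by_cases hx : x ∈ h
      · simp [hx]
      · simp [hx]
    rw [e2, hflow x, zero_mul]
  -- (2) rainbow triples have colour sum 0
  have hzero : ∀ h ∈ H, h ≠ h₀ → ∑ x ∈ h, c x = 0 := by
    intro h hh hneq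
    have hinj := hrain h hh hneq
    have hcard : (h.image c).card = 3 := by
      rw [Finset.card_image_of_injOn hinj]; exact h3 h hh
    have huniv : h.image c = Finset.univ := by
      apply Finset.eq_univ_of_card
      rw [hcard]; rfl
    rw [← Finset.sum_image (f := fun z => z) hinj, huniv]
    decide
  -- (3) hence S = y h₀ * (c u + c v + c w)
  have hsplit := Finset.add_sum_erase H (fun h => y h * (∑ x ∈ h, c x)) hh₀
  have hrest : ∑ h ∈ H.erase h₀, y h * (∑ x ∈ h, c x) = 0 := by
    refine Finset.sum_eq_zero ?_
    intro h hh
    rw [Finset.mem_erase] at hh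
    rw [hzero h hh.2 hh.1, mul_zero]
  rw [hrest, add_zero, hS] at hsplit
  -- hsplit : y h₀ * ∑ x ∈ h₀, c x = 0
  have hsum : ∑ x ∈ h₀, c x = c u + c v + c w := by
    rw [huvw]
    have h1 : u ∉ ({v, w} : Finset (Fin n)) := by
      simp [hne.1, hne.2.1]
    have h2 : v ∉ ({w} : Finset (Fin n)) := by
      simp [hne.2.2]
    rw [Finset.sum_insert h1, Finset.sum_insert h2, Finset.sum_singleton, add_assoc]
  rw [hsum] at hsplit
  -- (4) c u + c v + c w = c w - c u ≠ 0  (as 3 = 0 in Z₃)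
  have hnz : c u + c v + c w ≠ 0 := by
    rw [← huv]
    have key : ∀ a b : ZMod 3, b ≠ a → a + a + b ≠ 0 := by decide
    exact key (c u) (c w) hw
  -- (5) Z₃ has no zero divisors
  have nzd : ∀ a b : ZMod 3, a * b = 0 → b ≠ 0 → a = 0 := by decide
  exact nzd _ _ hsplit hnz

/-- shadow (2-section) edge set of a triple system. -/
def shadowEdges (H : Finset (Finset (Fin n))) : Finset (Sym2 (Fin n)) :=
  H.biUnion (fun h => h.offDiag.image (fun p => s(p.1, p.2)))

/-- linear triple system: two distinct triples share at most one vertex (so shadow edges are in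
bijection with (triple, pair) incidences). -/
def IsLinear (H : Finset (Finset (Fin n))) : Prop :=
  ∀ h ∈ H, ∀ h' ∈ H, h ≠ h' → (h ∩ h').card ≤ 1

/-- COROLLARY (statement): the shadow of a linear triple system all of whose hyperdegrees are
divisible by some `m ≥ 2` (e.g. an `r`-regular linear 3-graph, `r ≥ 2`) is never 4-edge-critical
in the sense of `AeaCutRectanglesCriticalSupport.IsEdgeCritical`.  Reduction to
`no_near_colouring_of_dvd_hdeg`: if the shadow `S` were edge-critical, pick `e ∈ S`; a proper
3-colouring of `S.erase e` is a colouring of `S` with exactly one monochromatic edge (since `S`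
itself is not 3-colourable), i.e. `monoTotal c H = 1` by linearity. -/
def RegularShadowNotCritical : Prop :=
  ∀ (n m : ℕ) (H : Finset (Finset (Fin n))), 2 ≤ m → (∀ h ∈ H, h.card = 3) → IsLinear H →
    (∀ v, m ∣ hdeg H v) →
    ¬ Summit.PneNP.PneNP.Theorems.AeaCutRectanglesCriticalSupport.IsEdgeCritical (shadowEdges H)


/-- COROLLARY (statement): in a 4-edge-critical edge set `S`, every family `H` of edge-disjoint
triangles of `S` is `Z₃`-acyclic (no non-zero vertex-flow); in particular `H.card ≤ n - 1` and a
linear 3-graph with `≥ n` triples never has a 4-edge-critical shadow.  Reduction to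
`flow_vanishes_at_defect`: for `h₀ ∈ H` pick an edge `e ⊆ h₀`; a proper colouring of `S.erase e`
is rainbow on every other triangle of `H` and has pattern `aab` on `h₀`. -/
def CriticalTrianglePackingsAcyclic : Prop :=
  ∀ (n : ℕ) (S : Finset (Sym2 (Fin n))) (H : Finset (Finset (Fin n))),
    Summit.PneNP.PneNP.Theorems.AeaCutRectanglesCriticalSupport.IsEdgeCritical S →
    (∀ h ∈ H, h.card = 3) → IsLinear H → (∀ h ∈ H, shadowEdges {h} ⊆ S) →
    ∀ y : Finset (Fin n) → ZMod 3, (∀ x : Fin n, ∑ h ∈ H.filter (fun h => x ∈ h), y h = 0) →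
      ∀ h ∈ H, y h = 0

/-- Design lemma D2 (statement only): in the Toft frame — vertex classes `A,B,C,D`, a perfect
matching `A–B`, a perfect matching `C–D`, `G[A]` and `G[D]` each 2-colourable after deleting ANY one
vertex (e.g. odd cycles), no edges inside `B`, inside `C`, or between non-adjacent classes, and an
arbitrary bipartite graph `K` between `B` and `C` — the whole graph is non-3-colourable ONLY IF `K` is
complete bipartite.  (If `b,c` are non-adjacent: colour `B∖b ↦ 1, b ↦ 2, C∖c ↦ 3, c ↦ 2`, the
`A`-partner of `b` with `1` and the rest of `A` from `{2,3}`, the `D`-partner of `c` with `3` and the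
rest of `D` from `{1,2}`.)  Hence dichotomy-forcing carries zero entropy (RESULTS-r2s2g12 §3 D2). -/
def ToftFrameDark (n : ℕ) : Prop :=
  ∀ (G : SimpleGraph (Fin n)) [DecidableRel G.Adj] (A B C D : Finset (Fin n)),
    Disjoint A B → Disjoint A C → Disjoint A D → Disjoint B C → Disjoint B D → Disjoint C D →
    (∀ u v, G.Adj u v → ((u ∈ A ∧ v ∈ A) ∨ (u ∈ D ∧ v ∈ D) ∨ (u ∈ A ∧ v ∈ B) ∨ (u ∈ B ∧ v ∈ A)
        ∨ (u ∈ C ∧ v ∈ D) ∨ (u ∈ D ∧ v ∈ C) ∨ (u ∈ B ∧ v ∈ C) ∨ (u ∈ C ∧ v ∈ B))) →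
    (∀ a ∈ A, ∃! b, b ∈ B ∧ G.Adj a b) → (∀ b ∈ B, ∃! a, a ∈ A ∧ G.Adj a b) →
    (∀ d ∈ D, ∃! c', c' ∈ C ∧ G.Adj c' d) → (∀ c' ∈ C, ∃! d, d ∈ D ∧ G.Adj c' d) →
    (∀ a ∈ A, (G.induce ((A.erase a : Finset (Fin n)) : Set (Fin n))).Colorable 2) →
    (∀ d ∈ D, (G.induce ((D.erase d : Finset (Fin n)) : Set (Fin n))).Colorable 2) →
    ¬ G.Colorable 3 →
    ∀ b ∈ B, ∀ c' ∈ C, G.Adj b c'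

end Summit.PneNP.PneNP.Cruxes.FoolingMeasure.IdeasR2s2g12
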